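import Literature.AnabelianGeometry.EtaleTheta.Discharge.Sec5OfQuotientTemperoid

/-!
# [EtTh] §5 data over the connected temperoid `B^temp(G)⁰` of a tempered QUOTIENT `φ : Π^tp_X ↠ G` (§5 pp.330–331 / PDF pp.104–105)

Mochizuki, *The étale theta function …*, Publ. RIMS **45** (2009)
[cite: MochizukiEtTh2009, §5 p.330–331 (PDF pp.104–105); Prop 4.3 (i) p.317 (PDF p.91); Lem 5.8 p.331 (PDF p.105)].
PAGE CONVENTION for [EtTh]: «printed N (PDF p.M)», N = M + 226.

abc-iut cell, layer L2, seat abc-iut-L2-t3 (gen 9; [EtTh] §3/§4 lineage), ROW R1114 «R-α1 QUOTIENT-BASE §5 SETTING» = bridge (J3a) of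
`HOME/staging/L2/L2-t3/g8/SIZING-Sec5JunctionAtThetaTwistTower-L2t3g8.md`; FILE 2 of 2 — the §5 data over the setting
`BiKummerSetting.mkOfQuotientTemperoid` of file 1 (`Discharge/Sec5OfQuotientTemperoid.lean`).  PROOF-SHAPED companion of abc-iut-L2-t4's
`Discharge/Sec5OfConnectedTemperoid.lean` §"The §5 data over `B^temp(Π^tp_X)⁰`" and `Discharge/Sec5OfConnectedTemperoidYddFacts.lean`,
with `B^temp(Π^tp_X)⁰` replaced by `B^temp(G)⁰` for a tempered `G` and a continuous surjection `φ : Π^tp_X ↠ G` (those files are the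
case `φ := id`, `mkOfQuotientTemperoid_id`).  ADDITIVE: nothing landed is touched.
* `ThetaFrobenioid.ofQuotientTemperoidData := ofBiKummerData …` VERBATIM (dictionary = identity) with `hopen` DISCHARGED
  (`mkOfQuotientTemperoid_isOpen_ker_galoisSurj`), `σ = s^trv_N := strvOfBiKummerData` CONSTRUCTED ([FrdI] Prop. 5.6), `hdivc`/`hdivp`
  from the divisor invariances `hinvc` (p.330) / `hinvp` (Prop. 4.3 (i) proof p.317); its `rfl` dictionary; `StrvSection`, `SgpCapSpec`,
  `SgpCupSpec`, `SgpCapSection`, `AutAmpleBN`; `biratAutAction_ofQuotientTemperoidData` (input `hconst`, Def. 3.6 (iii));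
* `facts_ofQuotientTemperoidData ⟸ {hH, hconst, hgc}` and, for the §5 choice `A_⊙^bs := Ÿ` of file 1 (`mkOfQuotientTemperoidYdd`, where
  `hH` is the theorem `hH_mkOfQuotientTemperoidYdd`), `facts_ofQuotientTemperoidYddData ⟸ {hconst, hgc}`;
* `hinvc_ofQuotientTemperoid` / `hinvp_ofQuotientTemperoid` — the divisor inputs from the `Π^tp_X`-stability `hθ`/`hθ'` of
  `Div(s')`/`Div(s'')` of the fraction-pair of `Θ̈` on `A_⊙` (naturality `hS` being the theorem `mkOfQuotientTemperoid_galoisSurj_natural`),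
  and `facts_ofQuotientTemperoidYddData_thetaDivisor` with them supplied.
INPUTS of the §5 data over `B^temp(G)⁰` after this file: `h` ([FrdI] Thm. 5.2 hypotheses), `Q`, the roots `Rl`, `R`, `ιX`, the constants
`(K', constEmb)`, `hθ`/`hθ'` (Prop. 1.4), `hconst` (Def. 3.6 (iii)), `hgc` (Lemma 5.8); `NH` stays a parameter; on the group side `G`, `hG`,
`φ`, `hφ` (and `hopenY` for the `Ÿ` choice, discharged for first-countable `G` in file 1).
HONEST FRAMING: constructions and kernel-checked implications over abc-iut-L2-t3's / abc-iut-L3's data structures; the parameter class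
`TemperedFrobenioid T₀ (ConnectedPart (BTemp G)) VD` is NOT shown inhabited for an actual curve here; [EtTh] is refereed; nothing here takes
a side on [IUTchIII] Cor. 3.12; typed ≠ proved.
-/

noncomputable section

namespace Literature.AnabelianGeometry.EtaleTheta

open CategoryTheory Opposite Literature.AlgebraicGeometry.Frobenioids Literature.AnabelianGeometry.SemiGraphs
  Literature.AnabelianGeometry.SemiGraphs.GaloisObjects

universe u₀ v₀ u w

/-! ## The §5 data over `B^temp(G)⁰` -/

namespace ThetaFrobenioid

section Data

variable {K : Type u₀} [Field K] {X : SemiGraphs.TemperedArithmeticGroup.{u₀} K}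
  {G : Type u} [Group G] [TopologicalSpace G] [IsTopologicalGroup G] {hG : IsTempered G}
  {φ : X.Pi →ₜ* G} {hφ : Function.Surjective φ}
  {D₀ : Type u₀} [Category.{v₀} D₀] {V : FrdIMonoidStub.{w}} {T₀ : RealifiedDivisorMonoids (D₀ := D₀) V}
  {VD : FrdICatStub.{u + 1, u, w} (ConnectedPart (BTemp G))}
  {tf : TemperedFrobenioid T₀ (ConnectedPart (BTemp G)) VD} {hZ : tf.monoidType = MonoidType.Z}
  {hP : ∀ A : (ConnectedPart (BTemp G))ᵒᵖ, IsPerfect (tf.Φ.carrier A)}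
  {NH : Subgroup (Field.absoluteGaloisGroup K) → tf.category → ℕ+ → Prop} {A₀ : tf.category}
  {hA₀ : PreFrobenioid.IsFrobeniusTrivial tf.toElem A₀} {hA₀' : SemiGraphs.IsGaloisObj A₀.base.obj}
  {pullFrac : ∀ {A A' : (BiKummerSetting.mkOfQuotientTemperoid X hG φ hφ tf hZ hP NH A₀ hA₀ hA₀').C} (_ : A' ⟶ A),
    (BiKummerSetting.mkOfQuotientTemperoid X hG φ hφ tf hZ hP NH A₀ hA₀ hA₀').biratUnits A →
      (BiKummerSetting.mkOfQuotientTemperoid X hG φ hφ tf hZ hP NH A₀ hA₀ hA₀').biratUnits A'}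
  {lv N : ℕ+} {T : ThetaEnvData.{max u w} N}
  {θ : (BiKummerSetting.mkOfQuotientTemperoid X hG φ hφ tf hZ hP NH A₀ hA₀ hA₀').biratUnits
    (BiKummerSetting.mkOfQuotientTemperoid X hG φ hφ tf hZ hP NH A₀ hA₀ hA₀').Aodot}
  {Bl : (BiKummerSetting.mkOfQuotientTemperoid X hG φ hφ tf hZ hP NH A₀ hA₀ hA₀').C}
  {Pl : (BiKummerSetting.mkOfQuotientTemperoid X hG φ hφ tf hZ hP NH A₀ hA₀ hA₀').FractionPair θ Bl}
  {Rl : (BiKummerSetting.mkOfQuotientTemperoid X hG φ hφ tf hZ hP NH A₀ hA₀ hA₀').NthRoot θ Pl lv pullFrac}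
  (h : ModelFrobenioid.Hypotheses tf.divisorMonoid tf.ratFnFunctor)
  (Q : FrobenioidTheta.ThetaSubquotientStub.{w} (ConnectedPart (BTemp G))) (odd_l : Odd (lv : ℕ))
  (R : (BiKummerSetting.mkOfQuotientTemperoid X hG φ hφ tf hZ hP NH A₀ hA₀ hA₀').NthRoot Rl.root Rl.pair N pullFrac)
  (ιX : T.PiX ≃ₜ* X.Pi) (K' : Type w) [Field K'] (constEmb : K'ˣ →* tf.biratUnitsModel R.BN)
  (constEmb_injective : Function.Injective constEmb)
  (hinvc : ∀ g : Aut R.AN.base,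
    pull tf.divisorMonoid g.hom (ModelFrobenioid.div R.pair.num) = ModelFrobenioid.div R.pair.num)
  (hinvp : ∀ y : T.PiX, y ∈ T.PiYdd →
    pull tf.divisorMonoid ((BiKummerSetting.mkOfQuotientTemperoid X hG φ hφ tf hZ hP NH A₀ hA₀ hA₀').galoisSurj R.AN.base
      R.αData.isGalois (ιX y)).hom (ModelFrobenioid.div R.pair.den) = ModelFrobenioid.div R.pair.den)

/-- **The [EtTh] §5 data over the connected temperoid `B^temp(G)⁰` of a tempered quotient `φ : Π^tp_X ↠ G`** (§5, pp.330–331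
(PDF pp.104–105)): `ofBiKummerData` over `mkOfQuotientTemperoid` (dictionary = identity) with `hopen` DISCHARGED,
`σ = s^trv_N := strvOfBiKummerData` CONSTRUCTED ([FrdI] Prop. 5.6 section of the Frobenius-trivial `A_N`), `hdivc`/`hdivp` from the
divisor invariances `hinvc` (p.330) / `hinvp` (Prop. 4.3 (i) proof, p.317) via `hdivc_of_pull_invariant` / `hdivp_of_pull_invariant`.
[cite: MochizukiEtTh2009, §5 p.330–331 (PDF pp.104–105)] -/
def ofQuotientTemperoidData :
    ThetaFrobenioid.{w} (BiKummerSetting.mkOfQuotientTemperoid X hG φ hφ tf hZ hP NH A₀ hA₀ hA₀').C (ConnectedPart (BTemp G)) :=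
  ofBiKummerData h (fun _ => MonoidHom.id _) Q odd_l R ιX
    (BiKummerSetting.mkOfQuotientTemperoid_isOpen_ker_galoisSurj X hG φ hφ tf hZ hP NH A₀ hA₀ hA₀' R.AN.base R.αData.isGalois)
    (strvOfBiKummerData h R) K' constEmb constEmb_injective
    (hdivc_of_pull_invariant h.isDivisorial R (strvOfBiKummerData h R) (baseMap_strvOfBiKummerData h R) hinvc)
    (hdivp_of_pull_invariant h.isDivisorial R ιX (strvOfBiKummerData h R) (baseMap_strvOfBiKummerData h R) hinvp)

/-- `ofQuotientTemperoidData` unfolds to `ofBiKummerData` with the discharged arguments (definitionally) — the rfl dictionary and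
every theorem of `FrobenioidThetaOfBiKummerData.lean` / `Discharge/Sec5OfModelData.lean` apply verbatim.
[cite: MochizukiEtTh2009, §5 p.330–331 (PDF pp.104–105)] -/
theorem ofQuotientTemperoidData_eq :
    ofQuotientTemperoidData h Q odd_l R ιX K' constEmb constEmb_injective hinvc hinvp =
      ofBiKummerData h (fun _ => MonoidHom.id _) Q odd_l R ιX
        (BiKummerSetting.mkOfQuotientTemperoid_isOpen_ker_galoisSurj X hG φ hφ tf hZ hP NH A₀ hA₀ hA₀' R.AN.base
          R.αData.isGalois)
        (strvOfBiKummerData h R) K' constEmb constEmb_injective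
        (hdivc_of_pull_invariant h.isDivisorial R (strvOfBiKummerData h R) (baseMap_strvOfBiKummerData h R) hinvc)
        (hdivp_of_pull_invariant h.isDivisorial R ιX (strvOfBiKummerData h R) (baseMap_strvOfBiKummerData h R)
          hinvp) := rfl

/-- `s^trv_N` of the data is the constructed section. [cite: MochizukiEtTh2009, §5 p.331 (PDF p.105)] -/
theorem ofQuotientTemperoidData_strv :
    (ofQuotientTemperoidData h Q odd_l R ιX K' constEmb constEmb_injective hinvc hinvp).strv = strvOfBiKummerData h R := rfl

/-- The tempered group `Π^tp_X` of the data is that of the §2 datum `T` (read in `Π^tp_X` through `ιX`, in `G` through `φ ∘ ιX`).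
[cite: MochizukiEtTh2009, §5 p.331 (PDF p.105)] -/
theorem ofQuotientTemperoidData_PiX :
    (ofQuotientTemperoidData h Q odd_l R ιX K' constEmb constEmb_injective hinvc hinvp).PiX = T.PiX := rfl

/-- **`StrvSection` is UNCONDITIONAL** (`σ` constructed). [cite: MochizukiEtTh2009, §5 p.331 (PDF p.105)] -/
theorem strvSection_ofQuotientTemperoidData :
    (ofQuotientTemperoidData h Q odd_l R ιX K' constEmb constEmb_injective hinvc hinvp).StrvSection :=
  strvSection_ofBiKummerData h _ Q odd_l R ιX _ _ K' constEmb constEmb_injective _ _ (baseMap_strvOfBiKummerData h R)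

/-- `SgpCapSpec`. [cite: MochizukiEtTh2009, §5 p.331 (PDF p.105)] -/
theorem sgpCapSpec_ofQuotientTemperoidData :
    (ofQuotientTemperoidData h Q odd_l R ιX K' constEmb constEmb_injective hinvc hinvp).SgpCapSpec :=
  sgpCapSpec_ofBiKummerData h _ Q odd_l R ιX _ _ K' constEmb constEmb_injective _ _

/-- `SgpCupSpec`. [cite: MochizukiEtTh2009, §5 p.331 (PDF p.105)] -/
theorem sgpCupSpec_ofQuotientTemperoidData :
    (ofQuotientTemperoidData h Q odd_l R ιX K' constEmb constEmb_injective hinvc hinvp).SgpCupSpec :=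
  sgpCupSpec_ofBiKummerData h _ Q odd_l R ιX _ _ K' constEmb constEmb_injective _ _

/-- `SgpCapSection`. [cite: MochizukiEtTh2009, §5 p.331 (PDF p.105)] -/
theorem sgpCapSection_ofQuotientTemperoidData :
    (ofQuotientTemperoidData h Q odd_l R ιX K' constEmb constEmb_injective hinvc hinvp).SgpCapSection :=
  sgpCapSection_ofBiKummerData h _ Q odd_l R ιX _ _ K' constEmb constEmb_injective _ _ (baseMap_strvOfBiKummerData h R)

/-- `AutAmpleBN` ("it follows that `B_N` is Aut-ample", p.330 (PDF p.104)). [cite: MochizukiEtTh2009, §5 p.330 (PDF p.104)] -/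
theorem autAmpleBN_ofQuotientTemperoidData :
    (ofQuotientTemperoidData h Q odd_l R ιX K' constEmb constEmb_injective hinvc hinvp).AutAmpleBN :=
  autAmpleBN_ofBiKummerData h _ Q odd_l R ιX _ _ K' constEmb constEmb_injective _ _ (baseMap_strvOfBiKummerData h R)

/-- **The natural action on `O^×(B_N^birat)`** (abc-iut-L2-t11's `BiratAutAction` via abc-iut-L2-t9's `biratAutModel`; input `hconst`,
Def. 3.6 (iii)).  [cite: MochizukiEtTh2009, Def 3.6 (iii) p.304 (PDF p.78); Lem 5.8 p.331 (PDF p.105)] -/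
def biratAutAction_ofQuotientTemperoidData
    (hconst : ∀ (e : Aut R.BN) (k : K'ˣ), tf.biratAutModel R.BN e (constEmb k) = constEmb k) :
    (ofQuotientTemperoidData h Q odd_l R ιX K' constEmb constEmb_injective hinvc hinvp).BiratAutAction :=
  biratAutAction_ofModelData h Q odd_l R ιX _ _ K' constEmb constEmb_injective _ _ hconst

/-- **`Facts` for the §5 data over `B^temp(G)⁰` from `hH` (`Π^tp_Ÿ ⊆ H_⊙`), `hconst` (Def. 3.6 (iii)) and `hgc` (Lemma 5.8's geometric
connectedness)** — every other §5 named input a THEOREM.  [cite: MochizukiEtTh2009, §5 p.330–331 (PDF pp.104–105); Lem 5.8 p.331 (PDF p.105)] -/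
theorem facts_ofQuotientTemperoidData
    (hH : ∀ y : T.PiX, y ∈ T.PiYdd → ιX y ∈ (BiKummerSetting.mkOfQuotientTemperoid X hG φ hφ tf hZ hP NH A₀ hA₀ hA₀').Hodot)
    (hconst : ∀ (e : Aut R.BN) (k : K'ˣ), tf.biratAutModel R.BN e (constEmb k) = constEmb k)
    (hgc : ∀ u : (ofQuotientTemperoidData h Q odd_l R ιX K' constEmb constEmb_injective hinvc hinvp).units
        (ofQuotientTemperoidData h Q odd_l R ιX K' constEmb constEmb_injective hinvc hinvp).BN,
      (∀ y ∈ (ofQuotientTemperoidData h Q odd_l R ιX K' constEmb constEmb_injective hinvc hinvp).imPiY,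
        (ofQuotientTemperoidData h Q odd_l R ιX K' constEmb constEmb_injective hinvc hinvp).sgpCap y *
          (u : Aut (ofQuotientTemperoidData h Q odd_l R ιX K' constEmb constEmb_injective hinvc hinvp).BN) *
          ((ofQuotientTemperoidData h Q odd_l R ιX K' constEmb constEmb_injective hinvc hinvp).sgpCap y)⁻¹ = u) →
      (ofQuotientTemperoidData h Q odd_l R ιX K' constEmb constEmb_injective hinvc hinvp).unitsToBirat
          (ofQuotientTemperoidData h Q odd_l R ιX K' constEmb constEmb_injective hinvc hinvp).BN u ∈
        (ofQuotientTemperoidData h Q odd_l R ιX K' constEmb constEmb_injective hinvc hinvp).constEmb.range) :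
    (ofQuotientTemperoidData h Q odd_l R ιX K' constEmb constEmb_injective hinvc hinvp).Facts :=
  facts_ofModelData_of_geomConnected h Q odd_l R ιX _ _ K' constEmb constEmb_injective _ _
    (baseMap_strvOfBiKummerData h R) hH hconst rfl hgc

include h in
/-- **`hinvc` over `B^temp(G)⁰` from the `Π^tp_X`-stability `hθ` of `Div(s')`** (`(s', s'')` the fraction-pair of `Θ̈` on `A_⊙`; §5 p.330
(PDF p.104); naturality `hS` a theorem here (`φ` onto), `Φ` divisorial by `h`).  [cite: MochizukiEtTh2009, §5 p.330 (PDF p.104); Prop 4.3 (i) p.317 (PDF p.91)] -/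
theorem hinvc_ofQuotientTemperoid
    (hθ : ∀ x : X.Pi, pull tf.divisorMonoid ((BiKummerSetting.mkOfQuotientTemperoid X hG φ hφ tf hZ hP NH A₀ hA₀ hA₀').galoisSurj
      A₀.base hA₀' x).hom (ModelFrobenioid.div Pl.num) = ModelFrobenioid.div Pl.num) (g : Aut R.AN.base) :
    pull tf.divisorMonoid g.hom (ModelFrobenioid.div R.pair.num) = ModelFrobenioid.div R.pair.num :=
  hinvc_of_thetaDivisor R h.isDivisorial
    (BiKummerSetting.mkOfQuotientTemperoid_galoisSurj_natural X hG φ hφ tf hZ hP NH A₀ hA₀ hA₀') hθ g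

include h in
/-- **`hinvp` over `B^temp(G)⁰` from the `Π^tp_X`-stability `hθ'` of `Div(s'')`** (Prop. 4.3 (i) proof, p.317 (PDF p.91)).
[cite: MochizukiEtTh2009, Prop 4.3 (i) p.317 (PDF p.91)] -/
theorem hinvp_ofQuotientTemperoid
    (hθ' : ∀ x : X.Pi, pull tf.divisorMonoid ((BiKummerSetting.mkOfQuotientTemperoid X hG φ hφ tf hZ hP NH A₀ hA₀ hA₀').galoisSurj
      A₀.base hA₀' x).hom (ModelFrobenioid.div Pl.den) = ModelFrobenioid.div Pl.den) (y : T.PiX) (hy : y ∈ T.PiYdd) :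
    pull tf.divisorMonoid ((BiKummerSetting.mkOfQuotientTemperoid X hG φ hφ tf hZ hP NH A₀ hA₀ hA₀').galoisSurj R.AN.base
      R.αData.isGalois (ιX y)).hom (ModelFrobenioid.div R.pair.den) = ModelFrobenioid.div R.pair.den :=
  hinvp_of_thetaDivisor R ιX h.isDivisorial
    (BiKummerSetting.mkOfQuotientTemperoid_galoisSurj_natural X hG φ hφ tf hZ hP NH A₀ hA₀ hA₀') hθ' y hy

end Data

/-! ## `A_⊙^bs := Ÿ` read in `G`: `Facts` from `hconst` and `hgc` alone -/

section Ydd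

-- Elaboration note: below, the surjectivity proof is passed BY NAME (`(hφ := hφ)`): unification through the `def` chain
-- `mkOfQuotientTemperoidYdd → mkOfQuotientTemperoidQuot → mkOfQuotientTemperoid` (file 1) does not assign this `Prop`-valued implicit.

variable {K : Type u₀} [Field K] {X : SemiGraphs.TemperedArithmeticGroup.{u₀} K}
  {G : Type u} [Group G] [TopologicalSpace G] [IsTopologicalGroup G] {hG : IsTempered G}
  {φ : X.Pi →ₜ* G} {hφ : Function.Surjective φ}
  {D₀ : Type u₀} [Category.{v₀} D₀] {V : FrdIMonoidStub.{w}} {T₀ : RealifiedDivisorMonoids (D₀ := D₀) V}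
  {VD : FrdICatStub.{u + 1, u, w} (ConnectedPart (BTemp G))}
  {tf : TemperedFrobenioid T₀ (ConnectedPart (BTemp G)) VD} {hZ : tf.monoidType = MonoidType.Z}
  {hP : ∀ A : (ConnectedPart (BTemp G))ᵒᵖ, IsPerfect (tf.Φ.carrier A)}
  {NH : Subgroup (Field.absoluteGaloisGroup K) → tf.category → ℕ+ → Prop}
  {lv N : ℕ+} {T : ThetaEnvData.{max u w} N} {ιX : T.PiX ≃ₜ* X.Pi}
  {hopenY : IsOpen (φ.toMonoidHom '' (ιX.toMonoidHom '' (T.PiYdd : Set T.PiX)))}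
  {pullFrac : ∀ {A A' : (BiKummerSetting.mkOfQuotientTemperoidYdd X hG φ hφ tf hZ hP NH T ιX hopenY).C} (_ : A' ⟶ A),
    (BiKummerSetting.mkOfQuotientTemperoidYdd X hG φ hφ tf hZ hP NH T ιX hopenY).biratUnits A →
      (BiKummerSetting.mkOfQuotientTemperoidYdd X hG φ hφ tf hZ hP NH T ιX hopenY).biratUnits A'}
  {θ : (BiKummerSetting.mkOfQuotientTemperoidYdd X hG φ hφ tf hZ hP NH T ιX hopenY).biratUnits
    (BiKummerSetting.mkOfQuotientTemperoidYdd X hG φ hφ tf hZ hP NH T ιX hopenY).Aodot}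
  {Bl : (BiKummerSetting.mkOfQuotientTemperoidYdd X hG φ hφ tf hZ hP NH T ιX hopenY).C}
  {Pl : (BiKummerSetting.mkOfQuotientTemperoidYdd X hG φ hφ tf hZ hP NH T ιX hopenY).FractionPair θ Bl}
  {Rl : (BiKummerSetting.mkOfQuotientTemperoidYdd X hG φ hφ tf hZ hP NH T ιX hopenY).NthRoot θ Pl lv pullFrac}
  (h : ModelFrobenioid.Hypotheses tf.divisorMonoid tf.ratFnFunctor)
  (Q : FrobenioidTheta.ThetaSubquotientStub.{w} (ConnectedPart (BTemp G))) (odd_l : Odd (lv : ℕ))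
  (R : (BiKummerSetting.mkOfQuotientTemperoidYdd X hG φ hφ tf hZ hP NH T ιX hopenY).NthRoot Rl.root Rl.pair N pullFrac)
  (K' : Type w) [Field K'] (constEmb : K'ˣ →* tf.biratUnitsModel R.BN) (constEmb_injective : Function.Injective constEmb)

section General

variable
  (hinvc : ∀ g : Aut R.AN.base,
    pull tf.divisorMonoid g.hom (ModelFrobenioid.div R.pair.num) = ModelFrobenioid.div R.pair.num)
  (hinvp : ∀ y : T.PiX, y ∈ T.PiYdd →
    pull tf.divisorMonoid ((BiKummerSetting.mkOfQuotientTemperoidYdd X hG φ hφ tf hZ hP NH T ιX hopenY).galoisSurj R.AN.base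
      R.αData.isGalois (ιX y)).hom (ModelFrobenioid.div R.pair.den) = ModelFrobenioid.div R.pair.den)

/-- **`Facts` for the §5 data over `B^temp(G)⁰` with `A_⊙^bs := Ÿ`, from `hconst` (Def. 3.6 (iii)) and `hgc` (Lemma 5.8's geometric
connectedness) ALONE** (`hH := hH_mkOfQuotientTemperoidYdd`).  [cite: MochizukiEtTh2009, §5 p.330–331 (PDF pp.104–105); Lem 5.8 p.331 (PDF p.105)] -/
theorem facts_ofQuotientTemperoidYddData
    (hconst : ∀ (e : Aut R.BN) (k : K'ˣ), tf.biratAutModel R.BN e (constEmb k) = constEmb k)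
    (hgc : ∀ u : (ofQuotientTemperoidData (hφ := hφ) h Q odd_l R ιX K' constEmb constEmb_injective hinvc hinvp).units
        (ofQuotientTemperoidData (hφ := hφ) h Q odd_l R ιX K' constEmb constEmb_injective hinvc hinvp).BN,
      (∀ y ∈ (ofQuotientTemperoidData (hφ := hφ) h Q odd_l R ιX K' constEmb constEmb_injective hinvc hinvp).imPiY,
        (ofQuotientTemperoidData (hφ := hφ) h Q odd_l R ιX K' constEmb constEmb_injective hinvc hinvp).sgpCap y *
          (u : Aut (ofQuotientTemperoidData (hφ := hφ) h Q odd_l R ιX K' constEmb constEmb_injective hinvc hinvp).BN) *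
          ((ofQuotientTemperoidData (hφ := hφ) h Q odd_l R ιX K' constEmb constEmb_injective hinvc hinvp).sgpCap y)⁻¹ = u) →
      (ofQuotientTemperoidData (hφ := hφ) h Q odd_l R ιX K' constEmb constEmb_injective hinvc hinvp).unitsToBirat
          (ofQuotientTemperoidData (hφ := hφ) h Q odd_l R ιX K' constEmb constEmb_injective hinvc hinvp).BN u ∈
        (ofQuotientTemperoidData (hφ := hφ) h Q odd_l R ιX K' constEmb constEmb_injective hinvc hinvp).constEmb.range) :
    (ofQuotientTemperoidData (hφ := hφ) h Q odd_l R ιX K' constEmb constEmb_injective hinvc hinvp).Facts :=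
  facts_ofQuotientTemperoidData (hφ := hφ) h Q odd_l R ιX K' constEmb constEmb_injective hinvc hinvp
    (BiKummerSetting.hH_mkOfQuotientTemperoidYdd X hG φ hφ tf hZ hP NH T ιX hopenY) hconst hgc

end General

section ThetaDivisor

variable
  (hθ : ∀ x : X.Pi, pull tf.divisorMonoid ((BiKummerSetting.mkOfQuotientTemperoidYdd X hG φ hφ tf hZ hP NH T ιX hopenY).galoisSurj
    (BiKummerSetting.mkOfQuotientTemperoidYdd X hG φ hφ tf hZ hP NH T ιX hopenY).Aodot.base
    (BiKummerSetting.mkOfQuotientTemperoidYdd X hG φ hφ tf hZ hP NH T ιX hopenY).isGalois_Aodot x).hom (ModelFrobenioid.div Pl.num) =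
      ModelFrobenioid.div Pl.num)
  (hθ' : ∀ x : X.Pi, pull tf.divisorMonoid ((BiKummerSetting.mkOfQuotientTemperoidYdd X hG φ hφ tf hZ hP NH T ιX hopenY).galoisSurj
    (BiKummerSetting.mkOfQuotientTemperoidYdd X hG φ hφ tf hZ hP NH T ιX hopenY).Aodot.base
    (BiKummerSetting.mkOfQuotientTemperoidYdd X hG φ hφ tf hZ hP NH T ιX hopenY).isGalois_Aodot x).hom (ModelFrobenioid.div Pl.den) =
      ModelFrobenioid.div Pl.den)

/-- **`Facts` for the §5 data over `B^temp(G)⁰` with `A_⊙^bs := Ÿ` and the divisor inputs supplied from the `Π^tp_X`-stability of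
`Div(Θ̈)_±`** — inputs exactly `h, Q, (Rl, R), ιX, (K', constEmb), hθ, hθ', hconst, hgc` (group side: `G, hG, φ, hφ, hopenY`).
[cite: MochizukiEtTh2009, §5 p.330–331 (PDF pp.104–105); Prop 4.3 (i) p.317 (PDF p.91); Lem 5.8 p.331 (PDF p.105)] -/
theorem facts_ofQuotientTemperoidYddData_thetaDivisor
    (hconst : ∀ (e : Aut R.BN) (k : K'ˣ), tf.biratAutModel R.BN e (constEmb k) = constEmb k)
    (hgc : ∀ u : (ofQuotientTemperoidData (hφ := hφ) h Q odd_l R ιX K' constEmb constEmb_injective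
          (hinvc_ofQuotientTemperoid (hφ := hφ) h R hθ) (hinvp_ofQuotientTemperoid (hφ := hφ) h R ιX hθ')).units
        (ofQuotientTemperoidData (hφ := hφ) h Q odd_l R ιX K' constEmb constEmb_injective
          (hinvc_ofQuotientTemperoid (hφ := hφ) h R hθ) (hinvp_ofQuotientTemperoid (hφ := hφ) h R ιX hθ')).BN,
      (∀ y ∈ (ofQuotientTemperoidData (hφ := hφ) h Q odd_l R ιX K' constEmb constEmb_injective
          (hinvc_ofQuotientTemperoid (hφ := hφ) h R hθ) (hinvp_ofQuotientTemperoid (hφ := hφ) h R ιX hθ')).imPiY,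
        (ofQuotientTemperoidData (hφ := hφ) h Q odd_l R ιX K' constEmb constEmb_injective
            (hinvc_ofQuotientTemperoid (hφ := hφ) h R hθ) (hinvp_ofQuotientTemperoid (hφ := hφ) h R ιX hθ')).sgpCap y *
          (u : Aut (ofQuotientTemperoidData (hφ := hφ) h Q odd_l R ιX K' constEmb constEmb_injective
            (hinvc_ofQuotientTemperoid (hφ := hφ) h R hθ) (hinvp_ofQuotientTemperoid (hφ := hφ) h R ιX hθ')).BN) *
          ((ofQuotientTemperoidData (hφ := hφ) h Q odd_l R ιX K' constEmb constEmb_injective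
            (hinvc_ofQuotientTemperoid (hφ := hφ) h R hθ) (hinvp_ofQuotientTemperoid (hφ := hφ) h R ιX hθ')).sgpCap y)⁻¹ = u) →
      (ofQuotientTemperoidData (hφ := hφ) h Q odd_l R ιX K' constEmb constEmb_injective
          (hinvc_ofQuotientTemperoid (hφ := hφ) h R hθ) (hinvp_ofQuotientTemperoid (hφ := hφ) h R ιX hθ')).unitsToBirat
          (ofQuotientTemperoidData (hφ := hφ) h Q odd_l R ιX K' constEmb constEmb_injective
            (hinvc_ofQuotientTemperoid (hφ := hφ) h R hθ) (hinvp_ofQuotientTemperoid (hφ := hφ) h R ιX hθ')).BN u ∈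
        (ofQuotientTemperoidData (hφ := hφ) h Q odd_l R ιX K' constEmb constEmb_injective
          (hinvc_ofQuotientTemperoid (hφ := hφ) h R hθ) (hinvp_ofQuotientTemperoid (hφ := hφ) h R ιX hθ')).constEmb.range) :
    (ofQuotientTemperoidData (hφ := hφ) h Q odd_l R ιX K' constEmb constEmb_injective
      (hinvc_ofQuotientTemperoid (hφ := hφ) h R hθ) (hinvp_ofQuotientTemperoid (hφ := hφ) h R ιX hθ')).Facts :=
  facts_ofQuotientTemperoidYddData h Q odd_l R K' constEmb constEmb_injective _ _ hconst hgc

end ThetaDivisor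

end Ydd

end ThetaFrobenioid

end Literature.AnabelianGeometry.EtaleTheta

end
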